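import Literature.NumberTheory.DiophantineApproximation.RhinViolaDoubleResidue
import Literature.NumberTheory.DiophantineApproximation.ViolaZudilinBinomialGlue
import HarnessLib

/-!
# The Viola–Zudilin integrals `J_z^{(μ)}(h,j,k,l,m,q)` (`μ = 0,1,2`) and their two binomial representations

Topic `Literature/NumberTheory/DiophantineApproximation`. DEFINITIONS with proved API; no named facts.

Viola–Zudilin [§2.1, p. 197 of the journal version = p. 5 of MPIM 2014-26] define, for `z > 1` and integers
`h, j, k, l, m, q ≥ 0` with `j+k−m, j+q−m ≥ 0`,

* `J_z^{(0)} = z^{k−l−q} ∫₀¹∫₀¹ x^j(1−x)^h y^k(1−y)^l (1−y+yz)^{j+q−m} dx dy / (x(1−y)+yz)^{j+k−m+1}`,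
* `J_z^{(1)}` = the same with the `y`-integration replaced by `(1/2πi)∮_{|y−x/(x−z)|=ϱ}` (the residue at the
  pole `y₀ = x/(x−z)` of order `j+k−m+1`),
* `J_z^{(2)}` = the same with, in addition, the `x`-integration replaced by `(1/2πi)∮_{|x−z|=σ}`,
* `J_z = J_z^{(0)} − (log z) J_z^{(1)}`,

"which clearly generalise (apart from the normalisation factor `z^{k−l−q}` in place of `z^{−l−m}`) the
corresponding families `I_z^{(μ)}` and `I_z` in [RV]". Exactly as for the tree's `RhinViola.innerRes`,
`RhinViola.I1`, `RhinViola.I2` (Cauchy's differentiation formula for the pole of order `n₁+1`,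
`n₁ = j+k−m`), the residues are written in closed Hasse-derivative form: with `g(Y) = Y^k(1−Y)^l(1−Y+zY)^{j+q−m}`,

* `res₁ z n₁ g x = (D^{(n₁)} g)(x/(x−z)) / (z−x)^{n₁+1}` — the inner residue for a general numerator `g`,
* `res₂ z n₁ D h j g = (−1)^{n₁+1} Σ_{i≤D} coeff_i((D^{(n₁)} g)∘(1+zW)) · (D^{(i+n₁)}(X^j(1−X)^h))(z)` — the
  double residue (the same formula as `RhinViola.I2`, for a general numerator of degree `≤ D`),

so that `J₁ = z^{k−l−q} ∫₀¹ x^j(1−x)^h res₁(g) dx`, `J₂ = z^{k−l−q} res₂(g)`, and `innerRes`, `I2` are the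
special case `g = Y^k(1−Y)^l` (`innerRes_eq_res₁`, `I2_eq_res₂`, by `rfl`).

Main results (the two displayed formulas in the proof of VZ Lemma 2.1, p. 6 of the preprint, for all three
`μ` and for `J_z`): with `N = j+q−m`,

* **second ("latter") representation** `J_z^{(μ)} = Σ_{λ=0}^{N} binom(N,λ) z^{k+m−q+λ} (z−1)^λ I_z^{(μ)}(h,j,k+λ,l,m+λ)`
  (`J₀_eq_sum_latter`, `J₁_eq_sum_latter`, `J₂_eq_sum_latter`, `J_eq_sum_latter`), from
  `(1−Y+zY)^N = (1 + (z−1)Y)^N`;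
* **first ("former") representation** `J_z^{(μ)} = Σ_{λ=0}^{N} binom(N,λ) z^{j+k+λ} I_z^{(μ)}(h,j,k+λ,j+l+q−m−λ,m+λ)`
  (`J₀_eq_sum_former`, …, `J_eq_sum_former`), from `(1−Y+zY)^N = ((1−Y) + zY)^N`;

both by linearity of the residue functionals in the numerator. Also `J0_eq_J₀`: the tree's power form
`ViolaZudilin.J0 z π n` (used for the asymptotics) is `J₀ z (hn) (jn) (kn) (ln) (mn) (qn)`.

## References

* C. Viola, W. Zudilin, *Linear independence of dilogarithmic values*, J. reine angew. Math. 736 (2018)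
  193–223 (= MPIM preprint 2014-26), §2.1 and Lemma 2.1 (proof). [ViolaZudilin2018]
* G. Rhin, C. Viola, Ann. Sc. Norm. Super. Pisa Cl. Sci. (5) 4 (2005) 389–437, (2.1)–(2.4). [RhinViola2005]
-/

noncomputable section

namespace Literature.NumberTheory.DiophantineApproximation

open Finset Polynomial
open _root_.MeasureTheory _root_.Set intervalIntegral

namespace RhinViola

/-! ### The residue functionals for a general numerator -/

/-- The inner residue for a general numerator `g(Y)`: the residue at `y₀ = x/(x−z)` of
`g(y) dy/(x(1−y)+yz)^{n₁+1} = g(y) dy/((z−x)^{n₁+1}(y−y₀)^{n₁+1})`, i.e. `(D^{(n₁)} g)(y₀)/(z−x)^{n₁+1}`.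
[cite: RhinViola2005, (2.2) and (2.10)] -/
def res₁ (z : ℝ) (n₁ : ℕ) (g : ℝ[X]) (x : ℝ) : ℝ :=
  (hasseDeriv n₁ g).eval (x / (x - z)) / (z - x) ^ (n₁ + 1)

/-- The double residue for a general numerator `g(Y)` of degree `≤ D` (the formula of `RhinViola.I2`).
[cite: RhinViola2005, (2.3)] -/
def res₂ (z : ℝ) (n₁ D h j : ℕ) (g : ℝ[X]) : ℝ :=
  (-1) ^ (n₁ + 1) * ∑ i ∈ range (D + 1),
    ((hasseDeriv n₁ g).comp (1 + C z * X)).coeff i * (hasseDeriv (i + n₁) ((X : ℝ[X]) ^ j * (1 - X) ^ h)).eval z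

/-- `innerRes` is `res₁` of `Y^k(1−Y)^l`. [cite: RhinViola2005, (2.2)] -/
theorem innerRes_eq_res₁ {j k m : ℕ} (hm : m ≤ j + k) (z : ℝ) (l : ℕ) (x : ℝ) :
    innerRes z j k l m x = res₁ z (j + k - m) (X ^ k * (1 - X) ^ l) x := by
  rw [innerRes, if_pos hm, res₁]

/-- Shifted parameters `(k+λ, m+λ)` have the same pole order. [cite: ViolaZudilin2018, Lemma 2.1 (proof)] -/
theorem innerRes_add_eq_res₁ {j k m : ℕ} (hm : m ≤ j + k) (z : ℝ) (l lam : ℕ) (x : ℝ) :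
    innerRes z j (k + lam) l (m + lam) x = res₁ z (j + k - m) (X ^ (k + lam) * (1 - X) ^ l) x := by
  rw [innerRes, if_pos (by omega), res₁, show j + (k + lam) - (m + lam) = j + k - m by omega]

/-- `I2` is `z^{−l−m} res₂` of `Y^k(1−Y)^l`. [cite: RhinViola2005, (2.3)] -/
theorem I2_eq_res₂ {j k m : ℕ} (hm : m ≤ j + k) (z : ℝ) (h l : ℕ) :
    I2 z h j k l m = z ^ (-((l : ℤ) + m)) * res₂ z (j + k - m) (k + l) h j (X ^ k * (1 - X) ^ l) := by
  rw [I2, if_pos hm, res₂]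

/-- Shifted parameters for `I2`. [cite: ViolaZudilin2018, Lemma 2.1 (proof)] -/
theorem I2_add_eq_res₂ {j k m : ℕ} (hm : m ≤ j + k) (z : ℝ) (h l lam : ℕ) :
    I2 z h j (k + lam) l (m + lam) =
      z ^ (-((l : ℤ) + (m + lam : ℕ))) * res₂ z (j + k - m) (k + lam + l) h j (X ^ (k + lam) * (1 - X) ^ l) := by
  rw [I2, if_pos (by omega), res₂, show j + (k + lam) - (m + lam) = j + k - m by omega]

/-- `res₁` is additive in the numerator. [folklore] -/
theorem res₁_add (z : ℝ) (n₁ : ℕ) (g₁ g₂ : ℝ[X]) (x : ℝ) :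
    res₁ z n₁ (g₁ + g₂) x = res₁ z n₁ g₁ x + res₁ z n₁ g₂ x := by
  simp [res₁, map_add, add_div]

/-- `res₁` is homogeneous in the numerator. [folklore] -/
theorem res₁_smul (z : ℝ) (n₁ : ℕ) (c : ℝ) (g : ℝ[X]) (x : ℝ) :
    res₁ z n₁ (c • g) x = c * res₁ z n₁ g x := by
  simp [res₁, map_smul, mul_div_assoc]

/-- `res₁` of a finite linear combination. [folklore] -/
theorem res₁_sum {ι : Type*} (s : Finset ι) (z : ℝ) (n₁ : ℕ) (c : ι → ℝ) (g : ι → ℝ[X]) (x : ℝ) :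
    res₁ z n₁ (∑ i ∈ s, c i • g i) x = ∑ i ∈ s, c i * res₁ z n₁ (g i) x := by
  classical
  induction s using Finset.induction_on with
  | empty => simp [res₁]
  | insert a s ha ih => rw [sum_insert ha, sum_insert ha, res₁_add, res₁_smul, ih]

/-- `res₂` is additive in the numerator. [folklore] -/
theorem res₂_add (z : ℝ) (n₁ D h j : ℕ) (g₁ g₂ : ℝ[X]) :
    res₂ z n₁ D h j (g₁ + g₂) = res₂ z n₁ D h j g₁ + res₂ z n₁ D h j g₂ := by
  simp only [res₂, map_add, add_comp, coeff_add, add_mul, sum_add_distrib, mul_add]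

/-- `res₂` is homogeneous in the numerator. [folklore] -/
theorem res₂_smul (z : ℝ) (n₁ D h j : ℕ) (c : ℝ) (g : ℝ[X]) :
    res₂ z n₁ D h j (c • g) = c * res₂ z n₁ D h j g := by
  simp only [res₂, map_smul, smul_comp, coeff_smul, smul_eq_mul, mul_sum]
  exact sum_congr rfl fun i _ => by ring

/-- `res₂` of a finite linear combination. [folklore] -/
theorem res₂_sum {ι : Type*} (s : Finset ι) (z : ℝ) (n₁ D h j : ℕ) (c : ι → ℝ) (g : ι → ℝ[X]) :
    res₂ z n₁ D h j (∑ i ∈ s, c i • g i) = ∑ i ∈ s, c i * res₂ z n₁ D h j (g i) := by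
  classical
  induction s using Finset.induction_on with
  | empty => simp [res₂]
  | insert a s ha ih => rw [sum_insert ha, sum_insert ha, res₂_add, res₂_smul, ih]

/-- The degree of `(D^{(n₁)} g) ∘ (1 + zW)` is at most that of `g`. [folklore] -/
theorem natDegree_hasseDeriv_comp_le' (z : ℝ) (n₁ : ℕ) (g : ℝ[X]) :
    ((hasseDeriv n₁ g).comp (1 + C z * X)).natDegree ≤ g.natDegree := by
  refine natDegree_comp_le.trans ?_
  have h1 : (1 + C z * X : ℝ[X]).natDegree ≤ 1 :=
    (natDegree_add_le _ _).trans (max_le (by simp) ((natDegree_C_mul_le _ _).trans natDegree_X_le))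
  calc (hasseDeriv n₁ g).natDegree * (1 + C z * X : ℝ[X]).natDegree
      ≤ g.natDegree * 1 := Nat.mul_le_mul ((natDegree_hasseDeriv_le _ _).trans (Nat.sub_le _ _)) h1
    _ = g.natDegree := mul_one _

/-- The truncation index `D` of `res₂` is immaterial beyond the degree of the numerator. [folklore] -/
theorem res₂_of_le {g : ℝ[X]} {D D' : ℕ} (hg : g.natDegree ≤ D) (hD : D ≤ D') (z : ℝ) (n₁ h j : ℕ) :
    res₂ z n₁ D' h j g = res₂ z n₁ D h j g := by
  unfold res₂
  congr 1
  symm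
  refine sum_subset (Finset.range_mono (by omega : D + 1 ≤ D' + 1)) fun i hi hi' => ?_
  have hiD : g.natDegree < i := by
    rw [Finset.mem_range] at hi hi'
    omega
  rw [coeff_eq_zero_of_natDegree_lt ((natDegree_hasseDeriv_comp_le' z n₁ g).trans_lt hiD), zero_mul]

/-! ### The two binomial expansions of the numerator -/

/-- `Y^k(1−Y)^l(1−Y+zY)^N = Σ_λ binom(N,λ)(z−1)^λ · Y^{k+λ}(1−Y)^l` (from `1−Y+zY = 1+(z−1)Y`).
[cite: ViolaZudilin2018, Lemma 2.1 (proof)] -/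
theorem numerator_eq_sum_latter (z : ℝ) (k l N : ℕ) :
    (X : ℝ[X]) ^ k * (1 - X) ^ l * (1 - X + C z * X) ^ N =
      ∑ lam ∈ range (N + 1), ((N.choose lam : ℝ) * (z - 1) ^ lam) • ((X : ℝ[X]) ^ (k + lam) * (1 - X) ^ l) := by
  have h1 : (1 - X + C z * X : ℝ[X]) = C (z - 1) * X + 1 := by
    rw [map_sub, C_1]; ring
  rw [h1, add_pow, mul_sum]
  refine sum_congr rfl fun lam _ => ?_
  rw [smul_eq_C_mul, map_mul, map_pow, map_natCast, one_pow, mul_one, mul_pow, pow_add]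
  ring

/-- `Y^k(1−Y)^l(1−Y+zY)^N = Σ_λ binom(N,λ) z^λ · Y^{k+λ}(1−Y)^{l+N−λ}` (from `1−Y+zY = (1−Y) + zY`).
[cite: ViolaZudilin2018, Lemma 2.1 (proof)] -/
theorem numerator_eq_sum_former (z : ℝ) (k l N : ℕ) :
    (X : ℝ[X]) ^ k * (1 - X) ^ l * (1 - X + C z * X) ^ N =
      ∑ lam ∈ range (N + 1), ((N.choose lam : ℝ) * z ^ lam) • ((X : ℝ[X]) ^ (k + lam) * (1 - X) ^ (l + N - lam)) := by
  have h1 : (1 - X + C z * X : ℝ[X]) = C z * X + (1 - X) := by ring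
  rw [h1, add_pow, mul_sum]
  refine sum_congr rfl fun lam hlam => ?_
  have hle : lam ≤ N := Nat.lt_succ_iff.1 (mem_range.1 hlam)
  rw [smul_eq_C_mul, map_mul, map_pow, map_natCast, mul_pow, pow_add, show l + N - lam = l + (N - lam) by omega,
    pow_add]
  ring

end RhinViola

namespace ViolaZudilin

open RhinViola (integrand I0 I1 I2 I innerRes res₁ res₂ integrableOn_integrand intervalIntegrable_I1_integrand
  innerRes_add_eq_res₁ I2_add_eq_res₂ res₁_sum res₂_sum res₂_of_le numerator_eq_sum_latter numerator_eq_sum_former)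

variable {z : ℝ}

/-! ### The definitions -/

/-- **`J_z^{(0)}(h,j,k,l,m,q) = z^{k−l−q} ∫∫_{[0,1]²} x^j(1−x)^h y^k(1−y)^l (1−y+yz)^{j+q−m} dx dy/(x(1−y)+yz)^{j+k−m+1}`**
(Viola–Zudilin §2.1), written with the tree's total integrand `RhinViola.integrand` (`= x^j(1−x)^h y^k(1−y)^l/D^{j+k−m+1}`
off the corner) times `(1−y+yz)^{j+q−m}`. [cite: ViolaZudilin2018, §2.1] -/
def J₀ (z : ℝ) (h j k l m q : ℕ) : ℝ :=
  z ^ ((k : ℤ) - l - q) * ∫ p in unitSquare, integrand z h j k l m p * denom₂ z p ^ (j + q - m)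

/-- **`J_z^{(1)}(h,j,k,l,m,q)`** (Viola–Zudilin §2.1): `z^{k−l−q} ∫₀¹ x^j(1−x)^h · Res_{y=x/(x−z)} dx`, the residue
of `y^k(1−y)^l(1−y+yz)^{j+q−m}/(x(1−y)+yz)^{j+k−m+1}` written by Cauchy's formula (`res₁`); `0` if `j+k < m`
(no pole). [cite: ViolaZudilin2018, §2.1] -/
def J₁ (z : ℝ) (h j k l m q : ℕ) : ℝ :=
  if m ≤ j + k then
    z ^ ((k : ℤ) - l - q) * ∫ x in (0 : ℝ)..1, x ^ j * (1 - x) ^ h *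
      res₁ z (j + k - m) (X ^ k * (1 - X) ^ l * (1 - X + C z * X) ^ (j + q - m)) x
  else 0

/-- **`J_z^{(2)}(h,j,k,l,m,q)`** (Viola–Zudilin §2.1): `z^{k−l−q}` times the double residue (`res₂`, the formula
of `RhinViola.I2` for the numerator `y^k(1−y)^l(1−y+yz)^{j+q−m}`); `0` if `j+k < m`. [cite: ViolaZudilin2018, §2.1] -/
def J₂ (z : ℝ) (h j k l m q : ℕ) : ℝ :=
  if m ≤ j + k then
    z ^ ((k : ℤ) - l - q) *
      res₂ z (j + k - m) (k + l + (j + q - m)) h j (X ^ k * (1 - X) ^ l * (1 - X + C z * X) ^ (j + q - m))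
  else 0

/-- **`J_z(h,j,k,l,m,q) = J_z^{(0)} − (log z) J_z^{(1)}`** (Viola–Zudilin §2.1; `log z` real). [cite: ViolaZudilin2018, §2.1] -/
def J (z : ℝ) (h j k l m q : ℕ) : ℝ :=
  J₀ z h j k l m q - Real.log z * J₁ z h j k l m q

/-! ### Pointwise identities for the real member -/

/-- `integrand(h,j,k+λ,l,m+λ) = y^λ · integrand(h,j,k,l,m)` (both vanish at the corner `D = 0`).
[cite: ViolaZudilin2018, Lemma 2.1 (proof)] -/
theorem integrand_add (z : ℝ) (h j k l m lam : ℕ) (p : ℝ × ℝ) :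
    integrand z h j (k + lam) l (m + lam) p = p.2 ^ lam * integrand z h j k l m p := by
  unfold integrand
  by_cases hD : denom₁ z p = 0
  · simp [hD]
  · rw [show j + (k + lam) + 1 = (j + k + 1) + lam by omega, pow_add, pow_add, pow_add]
    field_simp

/-- `integrand(h,j,k+λ,l+N−λ,m+λ) = y^λ (1−y)^{N−λ} · integrand(h,j,k,l,m)` for `λ ≤ N`.
[cite: ViolaZudilin2018, Lemma 2.1 (proof)] -/
theorem integrand_add' (z : ℝ) (h j k l m : ℕ) {N lam : ℕ} (hlam : lam ≤ N) (p : ℝ × ℝ) :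
    integrand z h j (k + lam) (l + N - lam) (m + lam) p = p.2 ^ lam * (1 - p.2) ^ (N - lam) * integrand z h j k l m p := by
  unfold integrand
  by_cases hD : denom₁ z p = 0
  · simp [hD]
  · rw [show j + (k + lam) + 1 = (j + k + 1) + lam by omega, show l + N - lam = l + (N - lam) by omega, pow_add,
      pow_add, pow_add, pow_add]
    field_simp

/-- The VZ integrand expanded the "latter" way. [cite: ViolaZudilin2018, Lemma 2.1 (proof)] -/
theorem integrand_mul_denom₂_pow_eq_sum_latter (z : ℝ) (h j k l m N : ℕ) (p : ℝ × ℝ) :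
    integrand z h j k l m p * denom₂ z p ^ N =
      ∑ lam ∈ range (N + 1), (N.choose lam : ℝ) * (z - 1) ^ lam * integrand z h j (k + lam) l (m + lam) p := by
  rw [denom₂_pow_eq_sum, mul_sum]
  refine sum_congr rfl fun lam _ => ?_
  rw [integrand_add, mul_pow]
  ring

/-- The VZ integrand expanded the "former" way. [cite: ViolaZudilin2018, Lemma 2.1 (proof)] -/
theorem integrand_mul_denom₂_pow_eq_sum_former (z : ℝ) (h j k l m N : ℕ) (p : ℝ × ℝ) :
    integrand z h j k l m p * denom₂ z p ^ N =
      ∑ lam ∈ range (N + 1), (N.choose lam : ℝ) * z ^ lam * integrand z h j (k + lam) (l + N - lam) (m + lam) p := by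
  have h1 : denom₂ z p = p.2 * z + (1 - p.2) := by rw [denom₂]; ring
  rw [h1, add_pow, mul_sum]
  refine sum_congr rfl fun lam hlam => ?_
  rw [integrand_add' z h j k l m (Nat.lt_succ_iff.1 (mem_range.1 hlam)), mul_pow]
  ring

/-! ### The second ("latter") representation -/

/-- `∫∫ integrand(T) = z^{l'+m'} I0(T)`. [cite: RhinViola2005, (2.1)] -/
theorem setIntegral_integrand_eq (hz : z ≠ 0) (h j k l m : ℕ) :
    ∫ p in unitSquare, integrand z h j k l m p = z ^ ((l : ℤ) + m) * I0 z h j k l m := by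
  rw [I0, ← mul_assoc, ← zpow_add₀ hz, add_neg_cancel, zpow_zero, one_mul]

/-- `∫₀¹ x^j(1−x)^h innerRes(T) = z^{l'+m'} I1(T)`. [cite: RhinViola2005, (2.2)] -/
theorem integral_innerRes_eq (hz : z ≠ 0) (h j k l m : ℕ) :
    ∫ x in (0 : ℝ)..1, x ^ j * (1 - x) ^ h * innerRes z j k l m x = z ^ ((l : ℤ) + m) * I1 z h j k l m := by
  rw [I1, ← mul_assoc, ← zpow_add₀ hz, add_neg_cancel, zpow_zero, one_mul]

/-- **VZ Lemma 2.1 (proof), second representation, `μ = 0`**: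
`J_z^{(0)} = Σ_λ binom(N,λ) z^{k+m−q+λ}(z−1)^λ I_z^{(0)}(h,j,k+λ,l,m+λ)`, `N = j+q−m`, `z ≥ 1`.
[cite: ViolaZudilin2018, Lemma 2.1 (proof)] -/
theorem J₀_eq_sum_latter (hz : 1 ≤ z) (h j k l m q : ℕ) :
    J₀ z h j k l m q = ∑ lam ∈ range (j + q - m + 1), ((j + q - m).choose lam : ℝ) *
      z ^ ((k : ℤ) + m - q + lam) * (z - 1) ^ lam * I0 z h j (k + lam) l (m + lam) := by
  have hz0 : z ≠ 0 := by positivity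
  rw [J₀, setIntegral_congr_fun measurableSet_unitSquare
    (fun p _ => integrand_mul_denom₂_pow_eq_sum_latter z h j k l m (j + q - m) p), integral_finsetSum _
    (fun lam _ => ((integrableOn_integrand hz _ _ _ _ _).const_mul _)), mul_sum]
  refine sum_congr rfl fun lam _ => ?_
  rw [MeasureTheory.integral_const_mul, setIntegral_integrand_eq hz0]
  have he : z ^ ((k : ℤ) - l - q) * z ^ ((l : ℤ) + (m + lam : ℕ)) = z ^ ((k : ℤ) + m - q + lam) := by
    rw [← zpow_add₀ hz0]; congr 1; push_cast; ring
  rw [← he]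
  ring

/-- **VZ Lemma 2.1 (proof), second representation, `μ = 1`** (`z > 1`, `m ≤ j+k`).
[cite: ViolaZudilin2018, Lemma 2.1 (proof)] -/
theorem J₁_eq_sum_latter (hz : 1 < z) {j k m : ℕ} (hm : m ≤ j + k) (h l q : ℕ) :
    J₁ z h j k l m q = ∑ lam ∈ range (j + q - m + 1), ((j + q - m).choose lam : ℝ) *
      z ^ ((k : ℤ) + m - q + lam) * (z - 1) ^ lam * I1 z h j (k + lam) l (m + lam) := by
  have hz0 : z ≠ 0 := by positivity
  rw [J₁, if_pos hm, numerator_eq_sum_latter]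
  simp_rw [res₁_sum, mul_sum]
  have hterm : ∀ lam : ℕ, ∀ x : ℝ, x ^ j * (1 - x) ^ h * (((j + q - m).choose lam : ℝ) * (z - 1) ^ lam *
      res₁ z (j + k - m) (X ^ (k + lam) * (1 - X) ^ l) x) = ((j + q - m).choose lam : ℝ) * (z - 1) ^ lam *
        (x ^ j * (1 - x) ^ h * innerRes z j (k + lam) l (m + lam) x) := by
    intro lam x; rw [innerRes_add_eq_res₁ hm]; ring
  simp_rw [hterm]
  rw [integral_finsetSum (fun lam _ => ((intervalIntegrable_I1_integrand hz _ _ _ _ _).const_mul _)), mul_sum]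
  refine sum_congr rfl fun lam _ => ?_
  rw [intervalIntegral.integral_const_mul, integral_innerRes_eq hz0]
  have he : z ^ ((k : ℤ) - l - q) * z ^ ((l : ℤ) + (m + lam : ℕ)) = z ^ ((k : ℤ) + m - q + lam) := by
    rw [← zpow_add₀ hz0]; congr 1; push_cast; ring
  rw [← he]
  ring

/-- **VZ Lemma 2.1 (proof), second representation, `μ = 2`** (`z ≠ 0`, `m ≤ j+k`).
[cite: ViolaZudilin2018, Lemma 2.1 (proof)] -/
theorem J₂_eq_sum_latter (hz : z ≠ 0) {j k m : ℕ} (hm : m ≤ j + k) (h l q : ℕ) :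
    J₂ z h j k l m q = ∑ lam ∈ range (j + q - m + 1), ((j + q - m).choose lam : ℝ) *
      z ^ ((k : ℤ) + m - q + lam) * (z - 1) ^ lam * I2 z h j (k + lam) l (m + lam) := by
  rw [J₂, if_pos hm, numerator_eq_sum_latter, res₂_sum, mul_sum]
  refine sum_congr rfl fun lam hlam => ?_
  have hle : lam ≤ j + q - m := Nat.lt_succ_iff.1 (mem_range.1 hlam)
  rw [I2_add_eq_res₂ hm, res₂_of_le (D := k + lam + l) ?_ (by omega)]
  · have he : z ^ ((k : ℤ) - l - q) = z ^ ((k : ℤ) + m - q + lam) * z ^ (-((l : ℤ) + (m + lam : ℕ))) := by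
      rw [← zpow_add₀ hz]; congr 1; push_cast; ring
    rw [he]
    ring
  · calc ((X : ℝ[X]) ^ (k + lam) * (1 - X) ^ l).natDegree ≤ (k + lam) * 1 + l * 1 := by
          refine (natDegree_mul_le).trans (add_le_add ?_ ?_)
          · exact (natDegree_pow_le).trans (by simp)
          · exact (natDegree_pow_le).trans (Nat.mul_le_mul_left _ ((natDegree_sub_le _ _).trans (by simp)))
      _ = k + lam + l := by ring

/-- **VZ Lemma 2.1 (proof), second representation, for `J_z`** (`z > 1`, `m ≤ j+k`).
[cite: ViolaZudilin2018, Lemma 2.1 (proof)] -/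
theorem J_eq_sum_latter (hz : 1 < z) {j k m : ℕ} (hm : m ≤ j + k) (h l q : ℕ) :
    J z h j k l m q = ∑ lam ∈ range (j + q - m + 1), ((j + q - m).choose lam : ℝ) *
      z ^ ((k : ℤ) + m - q + lam) * (z - 1) ^ lam * I z h j (k + lam) l (m + lam) := by
  rw [J, J₀_eq_sum_latter hz.le, J₁_eq_sum_latter hz hm, mul_sum, ← sum_sub_distrib]
  refine sum_congr rfl fun lam _ => ?_
  rw [RhinViola.I]
  ring

/-! ### The first ("former") representation -/

/-- **VZ Lemma 2.1 (proof), first representation, `μ = 0`**: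
`J_z^{(0)} = Σ_λ binom(N,λ) z^{j+k+λ} I_z^{(0)}(h,j,k+λ,j+l+q−m−λ,m+λ)` (`z ≥ 1`, `m ≤ j+q`).
[cite: ViolaZudilin2018, Lemma 2.1 (proof)] -/
theorem J₀_eq_sum_former (hz : 1 ≤ z) {j m q : ℕ} (hq : m ≤ j + q) (h k l : ℕ) :
    J₀ z h j k l m q = ∑ lam ∈ range (j + q - m + 1), ((j + q - m).choose lam : ℝ) *
      z ^ (j + k + lam) * I0 z h j (k + lam) (l + (j + q - m) - lam) (m + lam) := by
  have hz0 : z ≠ 0 := by positivity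
  rw [J₀, setIntegral_congr_fun measurableSet_unitSquare
    (fun p _ => integrand_mul_denom₂_pow_eq_sum_former z h j k l m (j + q - m) p), integral_finsetSum _
    (fun lam _ => ((integrableOn_integrand hz _ _ _ _ _).const_mul _)), mul_sum]
  refine sum_congr rfl fun lam hlam => ?_
  have hle : lam ≤ j + q - m := Nat.lt_succ_iff.1 (mem_range.1 hlam)
  rw [MeasureTheory.integral_const_mul, setIntegral_integrand_eq hz0]
  have he : z ^ ((k : ℤ) - l - q) * (z ^ lam * z ^ (((l + (j + q - m) - lam : ℕ) : ℤ) + (m + lam : ℕ))) =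
      z ^ (j + k + lam) := by
    rw [← zpow_natCast, ← zpow_add₀ hz0, ← zpow_add₀ hz0, ← zpow_natCast]
    congr 1
    have h1 : ((l + (j + q - m) - lam : ℕ) : ℤ) = l + (j + q - m : ℕ) - lam := by
      rw [Nat.cast_sub (by omega)]; push_cast; ring
    rw [h1, Nat.cast_sub hq]
    push_cast
    ring
  rw [← he]
  ring

/-- **VZ Lemma 2.1 (proof), first representation, `μ = 1`** (`z > 1`, `m ≤ j+k`, `m ≤ j+q`).
[cite: ViolaZudilin2018, Lemma 2.1 (proof)] -/
theorem J₁_eq_sum_former (hz : 1 < z) {j k m q : ℕ} (hm : m ≤ j + k) (hq : m ≤ j + q) (h l : ℕ) :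
    J₁ z h j k l m q = ∑ lam ∈ range (j + q - m + 1), ((j + q - m).choose lam : ℝ) *
      z ^ (j + k + lam) * I1 z h j (k + lam) (l + (j + q - m) - lam) (m + lam) := by
  have hz0 : z ≠ 0 := by positivity
  rw [J₁, if_pos hm, numerator_eq_sum_former]
  simp_rw [res₁_sum, mul_sum]
  have hterm : ∀ lam : ℕ, ∀ x : ℝ, x ^ j * (1 - x) ^ h * (((j + q - m).choose lam : ℝ) * z ^ lam *
      res₁ z (j + k - m) (X ^ (k + lam) * (1 - X) ^ (l + (j + q - m) - lam)) x) =
        ((j + q - m).choose lam : ℝ) * z ^ lam *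
          (x ^ j * (1 - x) ^ h * innerRes z j (k + lam) (l + (j + q - m) - lam) (m + lam) x) := by
    intro lam x; rw [innerRes_add_eq_res₁ hm]; ring
  simp_rw [hterm]
  rw [integral_finsetSum (fun lam _ => ((intervalIntegrable_I1_integrand hz _ _ _ _ _).const_mul _)), mul_sum]
  refine sum_congr rfl fun lam hlam => ?_
  have hle : lam ≤ j + q - m := Nat.lt_succ_iff.1 (mem_range.1 hlam)
  rw [intervalIntegral.integral_const_mul, integral_innerRes_eq hz0]
  have he : z ^ ((k : ℤ) - l - q) * (z ^ lam * z ^ (((l + (j + q - m) - lam : ℕ) : ℤ) + (m + lam : ℕ))) =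
      z ^ (j + k + lam) := by
    rw [← zpow_natCast, ← zpow_add₀ hz0, ← zpow_add₀ hz0, ← zpow_natCast]
    congr 1
    have h1 : ((l + (j + q - m) - lam : ℕ) : ℤ) = l + (j + q - m : ℕ) - lam := by
      rw [Nat.cast_sub (by omega)]; push_cast; ring
    rw [h1, Nat.cast_sub hq]
    push_cast
    ring
  rw [← he]
  ring

/-- **VZ Lemma 2.1 (proof), first representation, `μ = 2`** (`z ≠ 0`, `m ≤ j+k`, `m ≤ j+q`).
[cite: ViolaZudilin2018, Lemma 2.1 (proof)] -/
theorem J₂_eq_sum_former (hz : z ≠ 0) {j k m q : ℕ} (hm : m ≤ j + k) (hq : m ≤ j + q) (h l : ℕ) :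
    J₂ z h j k l m q = ∑ lam ∈ range (j + q - m + 1), ((j + q - m).choose lam : ℝ) *
      z ^ (j + k + lam) * I2 z h j (k + lam) (l + (j + q - m) - lam) (m + lam) := by
  rw [J₂, if_pos hm, numerator_eq_sum_former, res₂_sum, mul_sum]
  refine sum_congr rfl fun lam hlam => ?_
  have hle : lam ≤ j + q - m := Nat.lt_succ_iff.1 (mem_range.1 hlam)
  rw [I2_add_eq_res₂ hm, show k + lam + (l + (j + q - m) - lam) = k + l + (j + q - m) by omega]
  have he : z ^ ((k : ℤ) - l - q) * z ^ lam =
      z ^ (j + k + lam) * z ^ (-((((l + (j + q - m) - lam : ℕ) : ℤ)) + (m + lam : ℕ))) := by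
    rw [← zpow_natCast, ← zpow_add₀ hz, ← zpow_natCast, ← zpow_add₀ hz]
    congr 1
    have h1 : ((l + (j + q - m) - lam : ℕ) : ℤ) = l + (j + q - m : ℕ) - lam := by
      rw [Nat.cast_sub (by omega)]; push_cast; ring
    rw [h1, Nat.cast_sub hq]
    push_cast
    ring
  calc z ^ ((k : ℤ) - l - q) * (((j + q - m).choose lam : ℝ) * z ^ lam *
        res₂ z (j + k - m) (k + l + (j + q - m)) h j (X ^ (k + lam) * (1 - X) ^ (l + (j + q - m) - lam)))
      = ((j + q - m).choose lam : ℝ) * (z ^ ((k : ℤ) - l - q) * z ^ lam) *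
          res₂ z (j + k - m) (k + l + (j + q - m)) h j (X ^ (k + lam) * (1 - X) ^ (l + (j + q - m) - lam)) := by
        ring
    _ = _ := by rw [he]; ring

/-- **VZ Lemma 2.1 (proof), first representation, for `J_z`** (`z > 1`, `m ≤ j+k`, `m ≤ j+q`).
[cite: ViolaZudilin2018, Lemma 2.1 (proof)] -/
theorem J_eq_sum_former (hz : 1 < z) {j k m q : ℕ} (hm : m ≤ j + k) (hq : m ≤ j + q) (h l : ℕ) :
    J z h j k l m q = ∑ lam ∈ range (j + q - m + 1), ((j + q - m).choose lam : ℝ) *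
      z ^ (j + k + lam) * I z h j (k + lam) (l + (j + q - m) - lam) (m + lam) := by
  rw [J, J₀_eq_sum_former hz.le hq, J₁_eq_sum_former hz hm hq, mul_sum, ← sum_sub_distrib]
  refine sum_congr rfl fun lam _ => ?_
  rw [RhinViola.I]
  ring

/-! ### Link with the power form `J0 z π n` used for the asymptotics -/

/-- `J0 z π n = J₀ z (hn) (jn) (kn) (ln) (mn) (qn)` (`m ≤ j+k`). [cite: ViolaZudilin2018, §2.1 and (4.12)] -/
theorem J0_eq_J₀ (z : ℝ) (π : Params) (hm : π.m ≤ π.j + π.k) (n : ℕ) :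
    J0 z π n = J₀ z (π.h * n) (π.j * n) (π.k * n) (π.l * n) (π.m * n) (π.q * n) := by
  have hN : π.j * n + π.q * n - π.m * n = (π.j + π.q - π.m) * n := by
    rw [Nat.sub_mul, Nat.add_mul]
  have hexp : ((π.k : ℤ) - π.l - π.q) * n = ((π.k * n : ℕ) : ℤ) - (π.l * n : ℕ) - (π.q * n : ℕ) := by
    push_cast; ring
  rw [J0, J₀, hN, hexp]
  congr 1
  refine setIntegral_congr_fun measurableSet_unitSquare fun p _ => ?_
  rw [base_pow_mul_weight_eq_sum z π hm n p, integrand_mul_denom₂_pow_eq_sum_latter]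

end ViolaZudilin

end Literature.NumberTheory.DiophantineApproximation

end
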